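import Literature.Analysis.FluidPDE.PassiveVectorTensorEnergyDecay
import Literature.Analysis.FluidPDE.PassiveVectorTensorDissipationBound
import Literature.Analysis.FluidPDE.PassiveVectorTensorUniqueness
import HarnessLib

/-!
# Weak passive-vector solutions with a constant coercive tensor: the energy equality with a REAL, INTEGRABLE
# dissipation density dominating every truncated symbol form

Analysis/FluidPDE proof-support file (everything proved; no definitions, no named facts).  For the flat class
`Torus.IsWeakTensorPassiveVectorOn 0 T 𝔸 b w₀ w` (`∂ₜw + (b·∇)w + ∇π = 𝓛_𝔸 w`, `∇·w = 0`; Frisch (9.57)) with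
`NearIso 𝔸 lo hi`, `0 < lo`, `stLift b ∈ L^∞`, `w₀ ∈ L²` weakly divergence free, the energy equality
`PassiveVectorTensorEnergyDecay.ae_tendsto_setIntegral_symbForm` (`∫_{(0,t]} Q_N → (‖w₀‖² − ‖w(t)‖²)/2`,
`Q_N(s) = 4π² Σ_{|k|≤N} Re⟪ŵ(s)(k), T_𝔸(k)ŵ(s)(k)⟫`) is repackaged as:

* `exists_dissipationDensity` — there is `q : ℝ → ℝ`, INTEGRABLE on `(0,T)`, with `Q_N(s) ≤ q(s)` for every `N`
  and a.e. `s` (hence `0 ≤ q`), and `∫_{(0,t]} q = (‖w₀‖² − ‖w(t)‖²)/2` for a.e. `t ∈ (0,T)` —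
  i.e. `‖w(t)‖² = ‖w₀‖² − 2∫₀ᵗ q` with an honest Lebesgue density (`q = sup_N Q_N`; integrability on the whole of
  `(0,T)` from the upper Legendre–Hadamard window `Re⟪z, T_𝔸(k)z⟫ ≤ |hi|·|k|²‖z‖²` and the finite dissipation
  `∫₀ᵀ ‖∇w‖² < ∞`, `PassiveVectorTensorDissipationBound.eVectorDissipation_lt_top`).

This is the form in which absolutely-continuous-in-time Lyapunov functionals `A(t)‖w(t)‖² + …` are differentiated
(Temam 1984, Ch. III Lemma 1.2: the energy equation of the linear problem; Lions–Magenes regularity `w′ ∈ L²H⁻¹`).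
Consumer: cell `ad-ideate`, K1L_D `stmt-AnomalousDissipation-27980`, W3-E (i) (two-weight Lyapunov functional, re-plan P3b).

## Mathlib / tree search
Tree: `ae_tendsto_setIntegral_symbForm`, `ae_energy_ineq`, `ae_symbForm_mono`, `ae_re_inner_symbT_nonneg`, `integrableOn_symbForm`,
`eVectorDissipation_lt_top`, `re_inner_symbT_eq`, `ae_sum_mul_mFourierCoeff_eq_zero`, `eGradNormSq_eq_tsum`; the
`sup_N`-construction is the one inside `ae_integral_norm_sq_le_exp` (EnergyDecay), here exported with integrability.
Mathlib: `lintegral_iSup'`, `integrable_toReal_of_lintegral_ne_top`, `integral_toReal`, `ENNReal.ofReal_le_iff_le_toReal`.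

## References
* R. Temam, *Navier–Stokes Equations* (1984), Ch. III §1 Lemma 1.2. [`Temam1984`]
* U. Frisch, *Turbulence* (CUP 1995), §9.6.3 eq. (9.57) p. 233. [`Frisch1995Turbulence`]
-/

noncomputable section

open MeasureTheory Set Filter Function TopologicalSpace Complex UnitAddTorus
open scoped ENNReal NNReal InnerProductSpace Topology ComplexConjugate

namespace Literature.Analysis.FluidPDE

namespace Torus

variable {d : Type*} [Fintype d] [DecidableEq d]

namespace IsWeakTensorPassiveVectorOn

variable {T : ℝ} {𝔸 : Visc4 d} {b w : ℝ → UnitAddTorus d → EuclideanSpace ℝ d} {w₀ : UnitAddTorus d → EuclideanSpace ℝ d}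

omit [DecidableEq d] in
/-- **Upper Legendre–Hadamard window on transversal vectors**: `NearIso 𝔸 lo hi` and `k·z = 0` give
`Re⟪z, T_𝔸(k)z⟫ ≤ |hi|·|k|²‖z‖²` (the companion of `lo_mul_le_re_inner_symbT`). [cite: Frisch1995Turbulence, §9.6.3 eq. (9.57) p. 233] -/
theorem re_inner_symbT_le_abs_hi_mul {lo hi : ℝ} (h𝔸 : NearIso 𝔸 lo hi)
    {k : d → ℤ} {z : EuclideanSpace ℂ d} (hz : ∑ j, (k j : ℂ) * z j = 0) :
    (⟪z, symbT 𝔸 k z⟫_ℂ).re ≤ |hi| * (FunctionSpaces.Torus.freqNormSq k * ‖z‖ ^ 2) := by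
  -- transversality of the real and imaginary parts
  have hre : ∑ i, (z i).re * (k i : ℝ) = 0 := by
    have := congrArg Complex.re hz
    rw [Complex.re_sum, Complex.zero_re] at this
    rw [← this]
    refine Finset.sum_congr rfl fun i _ => ?_
    rw [← Complex.ofReal_intCast, Complex.re_ofReal_mul, mul_comm]
  have him : ∑ i, (z i).im * (k i : ℝ) = 0 := by
    have := congrArg Complex.im hz
    rw [Complex.im_sum, Complex.zero_im] at this
    rw [← this]
    refine Finset.sum_congr rfl fun i _ => ?_
    rw [← Complex.ofReal_intCast, Complex.im_ofReal_mul, mul_comm]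
  have h1 := (h𝔸 (fun a => (k a : ℝ)) (fun i => (z i).re) hre).2
  have h2 := (h𝔸 (fun a => (k a : ℝ)) (fun i => (z i).im) him).2
  have hnorm : ‖z‖ ^ 2 = ∑ i, (z i).re ^ 2 + ∑ i, (z i).im ^ 2 := by
    rw [EuclideanSpace.norm_sq_eq, ← Finset.sum_add_distrib]
    refine Finset.sum_congr rfl fun i _ => ?_
    rw [Complex.sq_norm, Complex.normSq_apply]
    ring
  rw [re_inner_symbT_eq, hnorm, FunctionSpaces.Torus.freqNormSq]
  have hk0 : 0 ≤ ∑ a, ((k a : ℤ) : ℝ) ^ 2 := Finset.sum_nonneg fun a _ => sq_nonneg _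
  have hr0 : 0 ≤ ∑ i, (z i).re ^ 2 := Finset.sum_nonneg fun i _ => sq_nonneg _
  have hi0 : 0 ≤ ∑ i, (z i).im ^ 2 := Finset.sum_nonneg fun i _ => sq_nonneg _
  have hhi : hi ≤ |hi| := le_abs_self hi
  nlinarith [h1, h2, mul_nonneg hk0 hr0, mul_nonneg hk0 hi0,
    mul_le_mul_of_nonneg_right hhi (mul_nonneg hk0 hr0), mul_le_mul_of_nonneg_right hhi (mul_nonneg hk0 hi0)]

/-- The truncated symbol form is dominated by `|hi|` times the spectral dissipation, in `ℝ≥0∞`: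
`ofReal Q_N(s) ≤ ofReal |hi| · eGradNormSq (w s)` for a.e. `s`. [cite: Frisch1995Turbulence, §9.6.3 eq. (9.57) p. 233] -/
theorem ae_ofReal_symbForm_le_eGradNormSq {A : ℝ} (h : IsWeakTensorPassiveVectorOn A T 𝔸 b w₀ w) {lo hi : ℝ}
    (h𝔸 : NearIso 𝔸 lo hi) :
    ∀ᵐ s ∂(volume.restrict (Ioo 0 T)), ∀ N : ℕ,
      ENNReal.ofReal (4 * Real.pi ^ 2 * ∑ k ∈ FunctionSpaces.Torus.freqBall N,
        (⟪mFourierCoeff (FunctionSpaces.EuclideanSpace.complexify ∘ w s) k,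
          symbT 𝔸 k (mFourierCoeff (FunctionSpaces.EuclideanSpace.complexify ∘ w s) k)⟫_ℂ).re) ≤
        ENNReal.ofReal |hi| * FunctionSpaces.Torus.eGradNormSq (w s) := by
  have htr := ae_all_iff.2 fun k => h.ae_sum_mul_mFourierCoeff_eq_zero k
  filter_upwards [htr] with s hs
  intro N
  set X : (d → ℤ) → EuclideanSpace ℂ d := fun k => mFourierCoeff (FunctionSpaces.EuclideanSpace.complexify ∘ w s) k
    with hX
  -- real bound of the finite sum
  have h1 : 4 * Real.pi ^ 2 * ∑ k ∈ FunctionSpaces.Torus.freqBall N, (⟪X k, symbT 𝔸 k (X k)⟫_ℂ).re ≤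
      |hi| * (4 * Real.pi ^ 2 * ∑ k ∈ FunctionSpaces.Torus.freqBall N, FunctionSpaces.Torus.freqNormSq k * ‖X k‖ ^ 2) := by
    rw [mul_left_comm, Finset.mul_sum, Finset.mul_sum, Finset.mul_sum]
    refine Finset.sum_le_sum fun k _ => ?_
    have := re_inner_symbT_le_abs_hi_mul h𝔸 (hs k)
    have h4 : (0:ℝ) ≤ 4 * Real.pi ^ 2 := by positivity
    exact mul_le_mul_of_nonneg_left this h4
  -- the finite spectral sum is below `eGradNormSq`
  have h2 : ENNReal.ofReal (4 * Real.pi ^ 2 * ∑ k ∈ FunctionSpaces.Torus.freqBall N,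
      FunctionSpaces.Torus.freqNormSq k * ‖X k‖ ^ 2) ≤ FunctionSpaces.Torus.eGradNormSq (w s) := by
    rw [FunctionSpaces.Torus.eGradNormSq_eq_tsum, ENNReal.ofReal_mul (by positivity),
      ENNReal.ofReal_sum_of_nonneg (fun k _ => mul_nonneg (FunctionSpaces.Torus.freqNormSq_nonneg k) (sq_nonneg _))]
    gcongr
    refine (Finset.sum_le_sum fun k _ => le_of_eq ?_).trans (ENNReal.sum_le_tsum _)
    rw [ENNReal.ofReal_mul (FunctionSpaces.Torus.freqNormSq_nonneg k), ← ofReal_norm, ← ENNReal.ofReal_pow (norm_nonneg _)]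
  calc ENNReal.ofReal (4 * Real.pi ^ 2 * ∑ k ∈ FunctionSpaces.Torus.freqBall N, (⟪X k, symbT 𝔸 k (X k)⟫_ℂ).re)
      ≤ ENNReal.ofReal (|hi| * (4 * Real.pi ^ 2 * ∑ k ∈ FunctionSpaces.Torus.freqBall N,
          FunctionSpaces.Torus.freqNormSq k * ‖X k‖ ^ 2)) := ENNReal.ofReal_le_ofReal h1
    _ = ENNReal.ofReal |hi| * ENNReal.ofReal (4 * Real.pi ^ 2 * ∑ k ∈ FunctionSpaces.Torus.freqBall N,
          FunctionSpaces.Torus.freqNormSq k * ‖X k‖ ^ 2) := ENNReal.ofReal_mul (abs_nonneg _)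
    _ ≤ ENNReal.ofReal |hi| * FunctionSpaces.Torus.eGradNormSq (w s) := by gcongr

/-- **THE ENERGY EQUALITY WITH AN INTEGRABLE DISSIPATION DENSITY.**  For `A = 0`, `NearIso 𝔸 lo hi`, `0 < lo`,
`stLift b ∈ L^∞((0,T) × 𝕋^d)` and an `L²` weakly divergence-free datum: there is `q : ℝ → ℝ`, integrable on `(0,T)`,
dominating every truncated symbol form (`Q_N(s) ≤ q(s)`, all `N`, a.e. `s`; so `0 ≤ q` a.e.), with
`∫_{(0,t]} q = (‖w₀‖² − ‖w(t)‖²)/2` for a.e. `t ∈ (0,T)`. [cite: Temam1984, Ch. III §1 Lemma 1.2] -/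
theorem exists_dissipationDensity (h : IsWeakTensorPassiveVectorOn 0 T 𝔸 b w₀ w) {lo hi : ℝ}
    (h𝔸 : NearIso 𝔸 lo hi) (hlo : 0 < lo) (hw₀ : MemLp w₀ 2 volume)
    (hdiv₀ : FunctionSpaces.Torus.IsWeaklyDivFree w₀)
    (hb : MemLp (FunctionSpaces.Torus.stLift b) ∞ (volume.restrict (Ioo 0 T ×ˢ univ))) :
    ∃ q : ℝ → ℝ, IntegrableOn q (Ioo 0 T) ∧
      (∀ᵐ s ∂(volume.restrict (Ioo 0 T)), ∀ N : ℕ,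
        4 * Real.pi ^ 2 * ∑ k ∈ FunctionSpaces.Torus.freqBall N,
          (⟪mFourierCoeff (FunctionSpaces.EuclideanSpace.complexify ∘ w s) k,
            symbT 𝔸 k (mFourierCoeff (FunctionSpaces.EuclideanSpace.complexify ∘ w s) k)⟫_ℂ).re ≤ q s) ∧
      (∀ᵐ s ∂(volume.restrict (Ioo 0 T)), 0 ≤ q s) ∧
      (∀ᵐ t ∂(volume.restrict (Ioo 0 T)),
        ∫ s in Ioc 0 t, q s = ((∫ x, ‖w₀ x‖ ^ 2) - ∫ x, ‖w t x‖ ^ 2) / 2) := by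
  classical
  -- ### notation
  set Q : ℕ → ℝ → ℝ := fun N s => 4 * Real.pi ^ 2 * ∑ k ∈ FunctionSpaces.Torus.freqBall N,
    (⟪mFourierCoeff (FunctionSpaces.EuclideanSpace.complexify ∘ w s) k,
      symbT 𝔸 k (mFourierCoeff (FunctionSpaces.EuclideanSpace.complexify ∘ w s) k)⟫_ℂ).re with hQ
  set E : ℝ → ℝ := fun s => ∫ x, ‖w s x‖ ^ 2 with hE
  set E₀ : ℝ := ∫ x, ‖w₀ x‖ ^ 2 with hE₀
  set Qs : ℝ → ℝ≥0∞ := fun s => ⨆ N : ℕ, ENNReal.ofReal (Q N s) with hQs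
  -- ### a.e.-in-`s` facts
  have hQint : ∀ N, IntegrableOn (Q N) (Ioo 0 T) := fun N => h.integrableOn_symbForm N
  have hmono : ∀ᵐ s ∂(volume.restrict (Ioo 0 T)), Monotone fun N : ℕ => Q N s := h.ae_symbForm_mono h𝔸 hlo.le
  have hQnn : ∀ᵐ s ∂(volume.restrict (Ioo 0 T)), ∀ N, 0 ≤ Q N s := by
    filter_upwards [h.ae_re_inner_symbT_nonneg h𝔸 hlo.le] with s hs
    intro N
    exact mul_nonneg (by positivity) (Finset.sum_nonneg fun k _ => hs k)
  have hQm : ∀ N, AEMeasurable (fun s => ENNReal.ofReal (Q N s)) (volume.restrict (Ioo 0 T)) := fun N =>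
    (hQint N).aestronglyMeasurable.aemeasurable.ennreal_ofReal
  have hQsm : AEMeasurable Qs (volume.restrict (Ioo 0 T)) := by
    rw [hQs]; exact AEMeasurable.iSup hQm
  -- ### finiteness of `∫⁻ Qs` on the whole of `(0,T)`
  have hdom : ∀ᵐ s ∂(volume.restrict (Ioo 0 T)), Qs s ≤ ENNReal.ofReal |hi| * FunctionSpaces.Torus.eGradNormSq (w s) := by
    filter_upwards [h.ae_ofReal_symbForm_le_eGradNormSq h𝔸] with s hs
    exact iSup_le fun N => hs N
  have hfin : ∫⁻ s in Ioo 0 T, Qs s ≠ ⊤ := by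
    have hD : eVectorDissipation lo w 0 T < ⊤ := h.eVectorDissipation_lt_top h𝔸 hlo hw₀ hdiv₀ hb
    unfold eVectorDissipation at hD
    have hG : ∫⁻ s in Ioo 0 T, FunctionSpaces.Torus.eGradNormSq (w s) ≠ ⊤ := by
      intro htop
      rw [htop, ENNReal.mul_top (by simpa using hlo)] at hD
      exact lt_irrefl _ hD
    refine ne_top_of_le_ne_top (b := ENNReal.ofReal |hi| * ∫⁻ s in Ioo 0 T, FunctionSpaces.Torus.eGradNormSq (w s))
      (ENNReal.mul_ne_top ENNReal.ofReal_ne_top hG) ?_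
    calc ∫⁻ s in Ioo 0 T, Qs s ≤ ∫⁻ s in Ioo 0 T, ENNReal.ofReal |hi| * FunctionSpaces.Torus.eGradNormSq (w s) :=
          lintegral_mono_ae hdom
      _ = ENNReal.ofReal |hi| * ∫⁻ s in Ioo 0 T, FunctionSpaces.Torus.eGradNormSq (w s) :=
          lintegral_const_mul' _ _ ENNReal.ofReal_ne_top
  have hlt : ∀ᵐ s ∂(volume.restrict (Ioo 0 T)), Qs s < ⊤ := ae_lt_top' hQsm hfin
  -- ### the density
  refine ⟨fun s => (Qs s).toReal, integrable_toReal_of_lintegral_ne_top hQsm hfin, ?_, ?_, ?_⟩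
  · filter_upwards [hlt] with s hs
    intro N
    exact (ENNReal.ofReal_le_iff_le_toReal hs.ne).1 (le_iSup (fun N : ℕ => ENNReal.ofReal (Q N s)) N)
  · exact ae_of_all _ fun s => ENNReal.toReal_nonneg
  · -- the energy identity with `Qs`, at a.e. `t`
    have hEq : ∀ᵐ t ∂(volume.restrict (Ioo 0 T)), ∫⁻ s in Ioc 0 t, Qs s = ENNReal.ofReal ((E₀ - E t) / 2) := by
      filter_upwards [h.ae_tendsto_setIntegral_symbForm h𝔸 hlo hw₀ hdiv₀ hb, ae_restrict_mem measurableSet_Ioo]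
        with t ht htI
      have hsub : Ioc 0 t ⊆ Ioo 0 T := Ioc_subset_Ioo_right htI.2
      have hmc : ∫⁻ s in Ioc 0 t, Qs s = ⨆ N : ℕ, ∫⁻ s in Ioc 0 t, ENNReal.ofReal (Q N s) := by
        rw [hQs]
        exact lintegral_iSup' (fun N => (hQm N).mono_measure (Measure.restrict_mono hsub le_rfl))
          (ae_restrict_of_ae_restrict_of_subset hsub
            (hmono.mono fun s hs N N' hNN' => ENNReal.ofReal_le_ofReal (hs hNN')))
      have heq : ∀ N, ∫⁻ s in Ioc 0 t, ENNReal.ofReal (Q N s) = ENNReal.ofReal (∫ s in Ioc 0 t, Q N s) := fun N =>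
        (ofReal_integral_eq_lintegral_ofReal ((hQint N).mono_set hsub)
          (ae_restrict_of_ae_restrict_of_subset hsub (hQnn.mono fun s hs => hs N))).symm
      simp_rw [heq] at hmc
      rw [hmc]
      have hmono' : Monotone fun N : ℕ => ENNReal.ofReal (∫ s in Ioc 0 t, Q N s) := by
        intro N N' hNN'
        refine ENNReal.ofReal_le_ofReal (integral_mono_ae ((hQint N).mono_set hsub) ((hQint N').mono_set hsub) ?_)
        exact ae_restrict_of_ae_restrict_of_subset hsub (hmono.mono fun s hs => hs hNN')
      exact tendsto_nhds_unique (tendsto_atTop_iSup hmono') (ENNReal.tendsto_ofReal ht)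
    have hEle : ∀ᵐ t ∂(volume.restrict (Ioo 0 T)), E t ≤ E₀ := by
      filter_upwards [h.ae_energy_ineq h𝔸 hlo hw₀ hdiv₀ hb] with t ht
      have h1 : ENNReal.ofReal (E t) ≤ ENNReal.ofReal E₀ := le_trans le_self_add ht
      exact (ENNReal.ofReal_le_ofReal_iff (integral_nonneg fun x => sq_nonneg _)).1 h1
    -- `Qs < ⊤` a.e. as a statement on `volume` restricted further
    have hlt' : ∀ᵐ s ∂(volume : Measure ℝ), s ∈ Ioo 0 T → Qs s < ⊤ := (ae_restrict_iff' measurableSet_Ioo).1 hlt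
    filter_upwards [hEq, hEle, ae_restrict_mem measurableSet_Ioo] with t ht hle htI
    have hsub : Ioc 0 t ⊆ Ioo 0 T := Ioc_subset_Ioo_right htI.2
    rw [integral_toReal (hQsm.mono_measure (Measure.restrict_mono hsub le_rfl))
      ((ae_restrict_iff' measurableSet_Ioc).2 (hlt'.mono fun s hs hsI => hs (hsub hsI))), ht,
      ENNReal.toReal_ofReal (by linarith)]

end IsWeakTensorPassiveVectorOn

end Torus

end Literature.Analysis.FluidPDE

end
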